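import Mathlib
import HarnessLib.Audit
import Summits.PneNP.PneNP.Theorems.PstarUnionCovers
import Summits.PneNP.PneNP.Theorems.PstarGateUnit

/-!
# PLAN B for the fresh class: PEEL — substituting an XOR tip into its readers, and the XOR core (ROUND-24, memo §14.6 (T4))

FRONTIER range-avoidance ladder, rung F-N3, ROUND 24 (cell `pnp-ideate`, planner memo `r24/CORE-BOUND-NOTES.md` §14.6 TIPS CHAIN (T4) "PEEL: substituting
the tips turns each hanging output into a PENDANT of its reader(s)"; restricted-model proof complexity — nothing here bears on `P` versus `NP`).

* `peelK` — substitute the equation of an output `g` into a G-constraint `K = (C, G, t)` that reads the XOR variable `x` of `g`: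
  `(C ∆ {x, x′}, G ∪ {g}, t + y_g)` (`PstarGConstraint.gval_reader`); unchanged if `x ∉ C`;
* `satPair_insert_iff_peel` — if `x` is an XOR variable of `g` occurring in no output of `E` and `g` is not a monomial of the pair, then
  `(A, w)` is solvable over `E ∪ {g}` iff `(peelK A, peelK w)` is solvable over `E` (set `x` last) — whether or not `x` is read;
* `terminalNC_peel` — hence a `TerminalNC` core with an XOR tip stays `TerminalNC` after deleting the tip's output and peeling the pair (if non-empty);
* `xcore I M` — the XOR CORE: the union of the XOR-closed sub-families of `M` (`xcore_subset`, `xorClosed_xcore`, `xcore_eq_of_xorClosed`,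
  `xcore_erase_tip`: deleting an output with an XOR tip does not change the core; `exists_tip`: a family that is not XOR-closed has a tip).
-/

set_option linter.dupNamespace false -- `Summit.PneNP.PneNP.…`: summit = sub-problem name (D-0017 single-conjunct layout)

open Finset Literature.Computability.Complexity
open scoped symmDiff
open Summit.PneNP.PneNP.Theorems.PstarFibrePolys (bit bit_injective)
open Summit.PneNP.PneNP.Theorems.PstarTyped (Typed)
open Summit.PneNP.PneNP.Theorems.PstarSALevel (varSet bdry BoundaryExpanding SimpleOverlap)
open Summit.PneNP.PneNP.Theorems.PstarGapPeeling (not_mem_varSet_of_private eval_update_of_not_mem eval_update_xor_slot)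
open Summit.PneNP.PneNP.Theorems.PstarCentreFree (vars_mem_varSet)
open Summit.PneNP.PneNP.Theorems.PstarNorCoreTools (not_mem_bdry_of_two)
open Summit.PneNP.PneNP.Theorems.PstarGapOneAll (gval)
open Summit.PneNP.PneNP.Theorems.PstarGConstraint (gval_update_of_forall_ne bit_gval_update_xor gval_reader)
open Summit.PneNP.PneNP.Theorems.PstarCoreBound (XorClosed)
open Summit.PneNP.PneNP.Theorems.PstarGateUnit (mem_bdry_of_unique)
open Summit.PneNP.PneNP.Theorems.PstarUnion (SatPair)
open Summit.PneNP.PneNP.Theorems.PstarUnionCovers (TerminalNC)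

namespace Summit.PneNP.PneNP.Theorems.PstarTipsPeel

variable {n m : ℕ}

/-! ## Peeling a G-constraint -/

/-- **Substitute the equation of `g` into a G-constraint reading the XOR variable `x` of `g`:** `(C ∆ {x, x′}, G ∪ {g}, t + y_g)`; unchanged if
`x ∉ C`. -/
def peelK (I : LocalMap 4 n m) (y : Fin m → Bool) (g : Fin m) (x : Fin n) (K : Finset (Fin n) × Finset (Fin m) × Bool) :
    Finset (Fin n) × Finset (Fin m) × Bool :=
  if x ∈ K.1 then (K.1 ∆ {I.vars g 0, I.vars g 1}, insert g K.2.1, xor K.2.2 (y g)) else K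

/-- The monomials of the peeled constraint. -/
theorem peelK_monomials_subset (I : LocalMap 4 n m) (y : Fin m → Bool) (g : Fin m) (x : Fin n) (K : Finset (Fin n) × Finset (Fin m) × Bool) :
    (peelK I y g x K).2.1 ⊆ insert g K.2.1 := by
  unfold peelK
  split_ifs
  · exact Subset.refl _
  · exact subset_insert g _

/-- **Value of the peeled constraint at a point satisfying `g`.** -/
theorem peelK_holds_iff (I : LocalMap 4 n m) (hI : I.IsPure xorAndPred) (y : Fin m → Bool) {g : Fin m} {x : Fin n}
    {K : Finset (Fin n) × Finset (Fin m) × Bool} (hg : g ∉ K.2.1) {z : Fin n → Bool} (hz : I.eval z g = y g) :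
    gval I (peelK I y g x K).1 (peelK I y g x K).2.1 z = (peelK I y g x K).2.2 ↔ gval I K.1 K.2.1 z = K.2.2 := by
  unfold peelK
  split_ifs with hx
  · simp only
    rw [gval_reader I hI K.1 hg z, hz]
    constructor
    · intro h
      have e : ∀ a b c : Bool, xor a c = xor b c → a = b := by decide
      exact e _ _ _ h
    · intro h; rw [h]
  · exact Iff.rfl

/-- **The peeled constraint does not see the tip** (`x` an XOR variable of `g`, typed instance). -/
theorem peelK_update (I : LocalMap 4 n m) (hT : Typed I) (y : Fin m → Bool) (g : Fin m) {s : Fin 4}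
    (hs : s.val < 2) (K : Finset (Fin n) × Finset (Fin m) × Bool) (z : Fin n → Bool) (b : Bool) :
    gval I (peelK I y g (I.vars g s) K).1 (peelK I y g (I.vars g s) K).2.1 (Function.update z (I.vars g s) b) =
      gval I (peelK I y g (I.vars g s) K).1 (peelK I y g (I.vars g s) K).2.1 z := by
  classical
  have hpairs : ∀ g' ∈ insert g K.2.1, I.vars g' 2 ≠ I.vars g s ∧ I.vars g' 3 ≠ I.vars g s := fun g' _ =>
    ⟨(hT g g' s 2 hs (by decide)).symm, (hT g g' s 3 hs (by decide)).symm⟩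
  unfold peelK
  split_ifs with hx
  · refine gval_update_of_forall_ne I z (fun h => ?_) hpairs b
    have h01 : I.vars g s ∈ ({I.vars g 0, I.vars g 1} : Finset (Fin n)) := by
      have : s = 0 ∨ s = 1 := by
        rcases s with ⟨_ | _ | k, hk⟩
        · exact Or.inl rfl
        · exact Or.inr rfl
        · exact absurd hs (by simp)
      rcases this with rfl | rfl
      · exact mem_insert_self _ _
      · exact mem_insert_of_mem (mem_singleton_self _)
    rcases Finset.mem_symmDiff.1 h with ⟨-, h2⟩ | ⟨-, h2⟩
    · exact h2 h01
    · exact h2 hx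
  · exact gval_update_of_forall_ne I z hx (fun g' hg' => hpairs g' (mem_insert_of_mem hg')) b

/-- **PEEL: an output with an XOR tip is droppable after peeling the pair.**  If the XOR variable `x = vars g s` of `g` occurs in no output of `E`
and `g` is not a monomial of the pair, then `(A, w)` is solvable over `E ∪ {g}` iff `(peelK A, peelK w)` is solvable over `E`. -/
theorem satPair_insert_iff_peel (I : LocalMap 4 n m) (hI : I.IsPure xorAndPred) (hT : Typed I) (y : Fin m → Bool) {E : Finset (Fin m)}
    {g : Fin m} {s : Fin 4} (hs : s.val < 2) (hx : ∀ j ∈ E, I.vars g s ∉ varSet I j) {A w : Finset (Fin n) × Finset (Fin m) × Bool}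
    (hgA : g ∉ A.2.1) (hgw : g ∉ w.2.1) :
    SatPair I y (insert g E) A w ↔ SatPair I y E (peelK I y g (I.vars g s) A) (peelK I y g (I.vars g s) w) := by
  classical
  constructor
  · rintro ⟨z, hz, hA, hw⟩
    have hzg : I.eval z g = y g := hz g (mem_insert_self g E)
    exact ⟨z, fun j hj => hz j (mem_insert_of_mem hj), (peelK_holds_iff I hI y hgA hzg).2 hA, (peelK_holds_iff I hI y hgw hzg).2 hw⟩
  · rintro ⟨z, hz, hA, hw⟩
    by_cases hzg : I.eval z g = y g
    · refine ⟨z, fun j hj => ?_, (peelK_holds_iff I hI y hgA hzg).1 hA, (peelK_holds_iff I hI y hgw hzg).1 hw⟩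
      rcases mem_insert.1 hj with rfl | hj
      · exact hzg
      · exact hz j hj
    · -- flip the tip
      set z' := Function.update z (I.vars g s) (!z (I.vars g s)) with hz'
      have hzg' : I.eval z' g = y g := by
        rw [hz', eval_update_xor_slot I hI z g s hs]
        revert hzg; cases I.eval z g <;> cases y g <;> simp
      refine ⟨z', fun j hj => ?_, (peelK_holds_iff I hI y hgA hzg').1 (by rw [hz', peelK_update I hT y g hs]; exact hA),
        (peelK_holds_iff I hI y hgw hzg').1 (by rw [hz', peelK_update I hT y g hs]; exact hw)⟩
      rcases mem_insert.1 hj with rfl | hj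
      · exact hzg'
      · rw [hz', eval_update_of_not_mem I j z (hx j hj)]
        exact hz j hj

/-- **A `TerminalNC` core with an XOR tip stays `TerminalNC` after deleting the tip's output and peeling the pair** (if something is left). -/
theorem terminalNC_peel (I : LocalMap 4 n m) (hI : I.IsPure xorAndPred) (hT : Typed I) {r : ℕ} (y : Fin m → Bool) {M : Finset (Fin m)}
    {A w : Finset (Fin n) × Finset (Fin m) × Bool} (h : TerminalNC I r y M A w) {g : Fin m} (hg : g ∈ M) {s : Fin 4} (hs : s.val < 2)
    (htip : ∀ j ∈ M, j ≠ g → I.vars g s ∉ varSet I j) (hne : (M.erase g).Nonempty) :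
    TerminalNC I r y (M.erase g) (peelK I y g (I.vars g s) A) (peelK I y g (I.vars g s) w) := by
  classical
  obtain ⟨-, hMr, hdA, hdw, hr, hT3, hM0⟩ := h
  have hgA : g ∉ A.2.1 := fun h => (disjoint_left.1 hdA) hg h
  have hgw : g ∉ w.2.1 := fun h => (disjoint_left.1 hdw) hg h
  have hx : ∀ j ∈ M.erase g, I.vars g s ∉ varSet I j := fun j hj => htip j (mem_of_mem_erase hj) (ne_of_mem_erase hj)
  have key := satPair_insert_iff_peel I hI hT y hs hx hgA hgw
  rw [insert_erase hg] at key
  refine ⟨hne, (card_le_card (erase_subset g M)).trans_lt hMr, ?_, ?_, ?_, fun hs' => hT3 (key.2 hs'), fun f hf => ?_⟩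
  · refine disjoint_left.2 fun j hj hj' => ?_
    rcases mem_insert.1 (peelK_monomials_subset I y g _ A hj') with rfl | h
    · exact notMem_erase _ _ hj
    · exact (disjoint_left.1 hdA) (mem_of_mem_erase hj) h
  · refine disjoint_left.2 fun j hj hj' => ?_
    rcases mem_insert.1 (peelK_monomials_subset I y g _ w hj') with rfl | h
    · exact notMem_erase _ _ hj
    · exact (disjoint_left.1 hdw) (mem_of_mem_erase hj) h
  · refine (card_le_card (fun j hj => ?_)).trans hr
    simp only [mem_union] at hj ⊢
    rcases hj with (hj | hj) | hj
    · exact Or.inl (Or.inl (mem_of_mem_erase hj))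
    · rcases mem_insert.1 (peelK_monomials_subset I y g _ A hj) with rfl | h
      · exact Or.inl (Or.inl hg)
      · exact Or.inl (Or.inr h)
    · rcases mem_insert.1 (peelK_monomials_subset I y g _ w hj) with rfl | h
      · exact Or.inl (Or.inl hg)
      · exact Or.inr h
  · -- minimality at `f ≠ g`
    have hfg : f ≠ g := ne_of_mem_erase hf
    have hx' : ∀ j ∈ (M.erase g).erase f, I.vars g s ∉ varSet I j := fun j hj => hx j (mem_of_mem_erase hj)
    have key' := satPair_insert_iff_peel I hI hT y hs hx' hgA hgw
    have hins : insert g ((M.erase g).erase f) = M.erase f := by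
      ext j
      simp only [mem_insert, mem_erase]
      constructor
      · rintro (rfl | ⟨h1, -, h3⟩)
        · exact ⟨hfg.symm, hg⟩
        · exact ⟨h1, h3⟩
      · rintro ⟨h1, h2⟩
        by_cases hjg : j = g
        · exact Or.inl hjg
        · exact Or.inr ⟨h1, hjg, h2⟩
    rw [hins] at key'
    exact key'.1 (hM0 f (mem_of_mem_erase hf))

/-! ## The XOR core -/

/-- **The XOR CORE of `M`**: the union of its XOR-closed sub-families. -/
noncomputable def xcore (I : LocalMap 4 n m) (M : Finset (Fin m)) : Finset (Fin m) :=
  by classical exact M.filter fun f => ∃ S ∈ M.powerset, XorClosed I S ∧ f ∈ S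

/-- The core is a sub-family. -/
theorem xcore_subset (I : LocalMap 4 n m) (M : Finset (Fin m)) : xcore I M ⊆ M := by
  classical
  unfold xcore; exact filter_subset _ _

/-- Membership in the core. -/
theorem mem_xcore (I : LocalMap 4 n m) {M : Finset (Fin m)} {f : Fin m} : f ∈ xcore I M ↔ ∃ S ⊆ M, XorClosed I S ∧ f ∈ S := by
  classical
  unfold xcore
  rw [mem_filter]
  constructor
  · rintro ⟨-, S, hS, hX, hf⟩
    exact ⟨S, mem_powerset.1 hS, hX, hf⟩
  · rintro ⟨S, hS, hX, hf⟩
    exact ⟨hS hf, S, mem_powerset.2 hS, hX, hf⟩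

/-- An XOR-closed sub-family lies in the core. -/
theorem subset_xcore (I : LocalMap 4 n m) {M S : Finset (Fin m)} (hS : S ⊆ M) (hX : XorClosed I S) : S ⊆ xcore I M :=
  fun _ hf => (mem_xcore I).2 ⟨S, hS, hX, hf⟩

/-- In an XOR-closed family every XOR variable of a member has a second user. -/
theorem exists_second_user (I : LocalMap 4 n m) {S : Finset (Fin m)} (hX : XorClosed I S) {f : Fin m} (hf : f ∈ S) {s : Fin 4}
    (hs : s.val < 2) : ∃ j ∈ S, j ≠ f ∧ I.vars f s ∈ varSet I j := by
  by_contra h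
  push Not at h
  exact hX f hf s hs (mem_bdry_of_unique I hf (vars_mem_varSet I f s) fun j hj hv => by_contra fun hne => h j hj hne hv)

/-- **The core is XOR-closed.** -/
theorem xorClosed_xcore (I : LocalMap 4 n m) (M : Finset (Fin m)) : XorClosed I (xcore I M) := by
  intro f hf s hs hb
  obtain ⟨S, hS, hX, hfS⟩ := (mem_xcore I).1 hf
  obtain ⟨j, hj, hjf, hv⟩ := exists_second_user I hX hfS hs
  exact not_mem_bdry_of_two I hf (subset_xcore I hS hX hj) hjf.symm (vars_mem_varSet I f s) hv hb

/-- An XOR-closed family is its own core. -/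
theorem xcore_eq_of_xorClosed (I : LocalMap 4 n m) {M : Finset (Fin m)} (hX : XorClosed I M) : xcore I M = M :=
  Subset.antisymm (xcore_subset I M) (subset_xcore I (Subset.refl M) hX)

/-- **A family that is not XOR-closed has an XOR tip**: an XOR variable of some member used by no other member. -/
theorem exists_tip (I : LocalMap 4 n m) {M : Finset (Fin m)} (hX : ¬ XorClosed I M) :
    ∃ g ∈ M, ∃ s : Fin 4, s.val < 2 ∧ ∀ j ∈ M, j ≠ g → I.vars g s ∉ varSet I j := by
  unfold PstarCoreBound.XorClosed at hX
  push Not at hX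
  obtain ⟨g, hg, s, hs, hb⟩ := hX
  exact ⟨g, hg, s, hs, fun j hj hjg => not_mem_varSet_of_private I hg hj hjg hb (vars_mem_varSet I g s)⟩

/-- **Deleting an output with an XOR tip does not change the core.** -/
theorem xcore_erase_tip (I : LocalMap 4 n m) {M : Finset (Fin m)} {g : Fin m} (hg : g ∈ M) {s : Fin 4} (hs : s.val < 2)
    (htip : ∀ j ∈ M, j ≠ g → I.vars g s ∉ varSet I j) : xcore I (M.erase g) = xcore I M := by
  refine Subset.antisymm (fun f hf => ?_) (fun f hf => ?_)
  · obtain ⟨S, hS, hX, hfS⟩ := (mem_xcore I).1 hf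
    exact (mem_xcore I).2 ⟨S, hS.trans (erase_subset g M), hX, hfS⟩
  · obtain ⟨S, hS, hX, hfS⟩ := (mem_xcore I).1 hf
    refine (mem_xcore I).2 ⟨S, fun j hj => mem_erase.2 ⟨fun hjg => ?_, hS hj⟩, hX, hfS⟩
    subst hjg
    obtain ⟨j', hj', hj'g, hv⟩ := exists_second_user I hX hj hs
    exact htip j' (hS hj') hj'g hv

/-- The core of the empty family is empty. -/
theorem xcore_empty (I : LocalMap 4 n m) : xcore I (∅ : Finset (Fin m)) = ∅ :=
  subset_empty.1 (xcore_subset I ∅)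

end Summit.PneNP.PneNP.Theorems.PstarTipsPeel
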